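import Summits.PneNP.PneNP.Theorems.SzkEntropyPeaThreeNotInPSocketBridge
import Summits.PneNP.PneNP.Theorems.SzkEntropyPeaThreeNotInPSocketEncodeFP
import Summits.PneNP.PneNP.Theorems.SzkEntropyPeaThreeNotInPSocketPED
import Summits.PneNP.PneNP.Theorems.SzkEntropyPeaThreeNotInPStubTransfer
import HarnessLib

/-!
# Route SzkEntropy, crux `PeaThreeNotInP` (stmt-PneNP-10776), line `SketchIdeator3`, socket rider:
# `PEDBP ≤ₚ PED 3` and the entropy-difference socket

* `rawPED_toPED` (bridge for the `PED` side: the untyped data of `toPED` is `toPEDRaw`, via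
  `encodeBDDsRaw_eq`, `natOf_prod`, `natOf_idMap`);
* `PEDBP_polyTimeReducible_PED_three : PEDBP ≤ₚ PED 3` — Dvir–Gutfreund–Rothblum–Vadhan Thm 4.6 for
  deterministic branching programs (`stub_toPED_mem` + `stub_toPEDRawFP stub_encodeBDDsRawFP`);
* **socket**: `peaThreeNotInP_of_PEDBP_not_mem : PEDBP ∉ PromiseP → PeaThreeNotInP` (with the landed
  `PED 3 ≤_Cook PEA 3`, `stub_pedCookPea`) and `not_peaThreeMemBPP_of_PEDBP : PEDBP ∉ PromiseBPP' →
  ¬ PeaThreeMemBPP`.  Any promise problem with a certified one-bit entropy-difference presentation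
  by branching-program samplers (e.g. cube-smoothed lattice cosets, card `lattice-cube-smoothing`)
  plugs in here.

Sources: Z. Dvir, D. Gutfreund, G. N. Rothblum, S. Vadhan, ECCC TR10-160 (2010), Thm 4.5–4.6, §3;
O. Goldreich, *On promise problems* (2006), Def. 1.2–1.4 and §1.2 (Cook reductions).
-/

namespace Summit.PneNP.PneNP.Cruxes.PeaThreeNotInP.SocketBP

set_option linter.dupNamespace false -- `Summit.PneNP.PneNP.…`: summit = sub-problem name (D-0017)

open _root_.Computability Finset
open Literature.InformationTheory.Entropy
open Literature.Computability.Complexity Literature.Computability.Complexity.RandPoly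
open Literature.Computability.Cryptography (toInput fnList freshBDDs encodeBDDsMap encodeBDDs_fst_eq)
open CodeFP (natE pairE rawE listE)
open Summit.PneNP.PneNP.Theses.SzkEntropy (PeaThreeNotInP PeaThreeMemBPP)
open Summit.PneNP.PneNP.Theorems (szkEntropy_peaThreeNotInP_iff szkEntropy_peaThreeMemBPP_iff)
open Summit.PneNP.PneNP.Cruxes.PeaThreeNotInP.TensorIsoLine (pedE rawPED encode_eq_pedE natOf_prod
  shiftN stub_pedCookPea)

/-! ### `PEDBP ≤ₚ PED 3` and the entropy-difference socket -/

/-- The identity map as naturals. [folklore] -/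
theorem natOf_idMap (m : ℕ) : natOf (PolyMapF2.idMap m) = idMapRaw m := by
  simp only [natOf, PolyMapF2.idMap, idMapRaw, List.map_map, Function.comp_def, List.map_cons,
    List.map_nil]
  rw [← List.map_coe_finRange_eq_range, List.map_map]
  rfl

/-- **The untyped data of `toPED` is `toPEDRaw`.** [cite: DvirGutfreundRothblumVadhan2010, Thm 4.6] -/
theorem rawPED_toPED (I : PEDBPInst) : rawPED (toPED I) = toPEDRaw I := by
  have hN : ∀ (n : ℕ) (Bs : List RawBP), (encodeBDDsRaw n n Bs).1 = n + freshBDDs (compileAll n Bs) :=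
    fun n Bs => by rw [encodeBDDsRaw_eq]; exact encodeBDDs_fst_eq _
  have hP : ∀ (n : ℕ) (Bs : List RawBP),
      (encodeBDDsRaw n n Bs).2 = natOf (encodeBDDsMap n (compileAll n Bs)) :=
    fun n Bs => by rw [encodeBDDsRaw_eq]; exact (natOf_toFinMap _ _ _).symm
  unfold toPEDRaw rawPED toPED prodRaw
  simp only [hN, hP, Nat.add_sub_cancel_left, natOf_prod, natOf_idMap]
  rfl

/-- **DGRV Thm 4.6 (deterministic branching programs): entropy difference for branching-program
samplers Karp-reduces to `PED_{F₂,3}`.** [cite: DvirGutfreundRothblumVadhan2010, Thm 4.6] -/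
theorem PEDBP_polyTimeReducible_PED_three : PEDBP.PolyTimeReducible (PED 3) := by
  obtain ⟨F, hF, hFr⟩ := stub_toPEDRawFP stub_encodeBDDsRawFP
  have hred : ∀ I : PEDBPInst,
      F (PEDBPInst.encoding.encode I) = PEDInst.encoding.encode (toPED I) := by
    intro I
    rw [encode_eq_pedbpE, hFr, encode_eq_pedE, rawPED_toPED]
  refine ⟨F, hF, fun w hw => ?_, fun w hw => ?_⟩
  · have hw' := hw
    obtain ⟨I, -, rfl⟩ : ∃ I, I ∈ _ ∧ PEDBPInst.encoding.encode I = w := hw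
    rw [hred]
    exact stub_toPED_mem.1 I hw'
  · have hw' := hw
    obtain ⟨I, -, rfl⟩ : ∃ I, I ∈ _ ∧ PEDBPInst.encoding.encode I = w := hw
    rw [hred]
    exact stub_toPED_mem.2 I hw'

/-- **Entropy-difference socket: hardness of `PEDBP` gives the crux** (via `PEDBP ≤ₚ PED 3` and the
landed `PED 3 ≤_Cook PEA 3`).  Any promise problem with a certified one-bit entropy-difference
presentation by branching-program samplers plugs in here.
[cite: DvirGutfreundRothblumVadhan2010, Thm 4.6] -/
theorem peaThreeNotInP_of_PEDBP_not_mem (h : PEDBP ∉ PromiseP) : PeaThreeNotInP := by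
  rw [szkEntropy_peaThreeNotInP_iff]
  intro h3
  exact h (PromiseProblem.mem_PromiseP_of_polyTimeReducible_holds PEDBP_polyTimeReducible_PED_three
    (PromiseProblem.mem_PromiseP_of_cookReducible_holds _ _ (stub_pedCookPea 3) h3))

/-- **Randomised form**: if `PEDBP ∉ PromiseBPP'` then `PEA 3 ∉ PromiseBPP'` (`¬ PeaThreeMemBPP`),
hence (kill-switch exhaustiveness) the crux. [cite: DvirGutfreundRothblumVadhan2010, Thm 4.6] -/
theorem not_peaThreeMemBPP_of_PEDBP (h : PEDBP ∉ PromiseBPP') : ¬ PeaThreeMemBPP := by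
  rw [szkEntropy_peaThreeMemBPP_iff]
  intro h3
  exact h (PromiseProblem.mem_PromiseBPP'_of_polyTimeReducible_holds' PEDBP_polyTimeReducible_PED_three
    (PromiseProblem.mem_PromiseBPP'_of_cookReducible_holds _ _ (stub_pedCookPea 3) h3))


end Summit.PneNP.PneNP.Cruxes.PeaThreeNotInP.SocketBP
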